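import Mathlib

/-!
# Centre-of-mass fragmentation: the algebraic skeleton (solo paper §11.4, Theorem 11.4 / F′)

On the torus, multiplying the `N`-body ground state `Ψ₀` by a function `g(X₁)` of the
centre-of-mass coordinate (equivalently: superposing the Galilean boosts `e^{idk_L X₁}Ψ₀`, which are
exact eigenstates with energies `E₀ + d²k_L²N` in distinct momentum sectors) produces nonnegative
states of energy `E₀ + N∫|g′|²/∫|g|²` with the same pair correlations as `Ψ₀` and a FRAGMENTED
one-particle density matrix.  Three elementary ingredients of the proof are recorded here in
abstract form (no analysis enters):

* `two_mul_inner_sub_eq_neg_doubleCommutator` — the IMS / double-commutator identity: for a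
  symmetric `H` with `H Ψ = e Ψ` and a symmetric `G`,
  `2(⟪GΨ, H GΨ⟫ - e‖GΨ‖²) = -⟪Ψ, [G,[G,H]] Ψ⟫` with `[G,[G,H]] = GGH - 2GHG + HGG`
  (in the application `G = g(X₁)`, `-[G,[G,H]] = 2|∇G|² = 2N g′(X₁)²`: the energy cost of a
  centre-of-mass factor is `N⟨g′(X₁)²⟩/⟨g(X₁)²⟩`);
* `sum_mul_comp_le_of_injective` — the comb bound behind `γ_Φ(p,p) = Σ_d |c_d|² n(p - d k_L e₁)
  ≤ (max_d |c_d|²)·N`: a weighted sum of occupations along an injective comb of momenta is at most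
  the largest weight times the total particle number;
* `eigenvalue_re_le_of_diag_le_of_rowSum_le` — the Gershgorin/Schur step: every eigenvalue of a
  finite complex matrix has real part at most (max diagonal real part) + (max off-diagonal
  absolute row sum); applied to finite sections of `γ_Φ` it gives
  `λ_max(γ_Φ) ≤ (max_d|c_d|²)N + ‖c‖²_{ℓ¹}(4E₀N)^{1/2}/(k_L(N-1))`.
-/

namespace Summit.AtomisticToContinuum.BoseEinsteinCondensation.Theorems

open scoped InnerProductSpace ComplexConjugate

section IMS

variable {E : Type*} [NormedAddCommGroup E] [InnerProductSpace ℂ E]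

/-- **IMS / double-commutator identity.** For symmetric `H`, `G` and an eigenvector `H Ψ = e Ψ`
(`e` real): `2(⟪GΨ, H(GΨ)⟫ - e‖GΨ‖²) = -⟪Ψ, (GGH - 2GHG + HGG) Ψ⟫`. -/
theorem two_mul_inner_sub_eq_neg_doubleCommutator (H G : E →ₗ[ℂ] E) (hH : H.IsSymmetric)
    (hG : G.IsSymmetric) {Ψ : E} {e : ℝ} (hΨ : H Ψ = (e : ℂ) • Ψ) :
    2 * (⟪G Ψ, H (G Ψ)⟫_ℂ - (e : ℂ) * (‖G Ψ‖ : ℂ) ^ 2)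
      = - ⟪Ψ, G (G (H Ψ)) - (2 : ℂ) • G (H (G Ψ)) + H (G (G Ψ))⟫_ℂ := by
  have t1 : ⟪Ψ, G (G (H Ψ))⟫_ℂ = (e : ℂ) * (‖G Ψ‖ : ℂ) ^ 2 := by
    rw [hΨ, map_smul, map_smul, inner_smul_right, ← hG, inner_self_eq_norm_sq_to_K]
    exact rfl
  have t2 : ⟪Ψ, G (H (G Ψ))⟫_ℂ = ⟪G Ψ, H (G Ψ)⟫_ℂ := by rw [← hG]
  have t3 : ⟪Ψ, H (G (G Ψ))⟫_ℂ = (e : ℂ) * (‖G Ψ‖ : ℂ) ^ 2 := by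
    rw [← hH, hΨ, inner_smul_left, ← hG, inner_self_eq_norm_sq_to_K, Complex.conj_ofReal]
    exact rfl
  rw [inner_add_right, inner_sub_right, inner_smul_right, t1, t2, t3]
  ring

/-- Real form of the IMS identity: the energy excess of `GΨ` over the eigenvalue equals
`-(1/2) re ⟪Ψ, [G,[G,H]] Ψ⟫`; in particular it is `≥ 0` resp. `≤ B` as soon as the double
commutator is `≤ 0` resp. `≥ -2B` in the state `Ψ`. -/
theorem inner_sub_eigenvalue_mul_norm_sq_eq (H G : E →ₗ[ℂ] E) (hH : H.IsSymmetric)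
    (hG : G.IsSymmetric) {Ψ : E} {e : ℝ} (hΨ : H Ψ = (e : ℂ) • Ψ) :
    (⟪G Ψ, H (G Ψ)⟫_ℂ).re - e * ‖G Ψ‖ ^ 2
      = - (1 / 2) * (⟪Ψ, G (G (H Ψ)) - (2 : ℂ) • G (H (G Ψ)) + H (G (G Ψ))⟫_ℂ).re := by
  have h := congrArg Complex.re (two_mul_inner_sub_eq_neg_doubleCommutator H G hH hG hΨ)
  have r1 : ((e : ℂ) * (‖G Ψ‖ : ℂ) ^ 2).re = e * ‖G Ψ‖ ^ 2 := by
    rw [← Complex.ofReal_pow, ← Complex.ofReal_mul, Complex.ofReal_re]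
  rw [Complex.neg_re] at h
  have h2 : (2 * (⟪G Ψ, H (G Ψ)⟫_ℂ - (e : ℂ) * (‖G Ψ‖ : ℂ) ^ 2)).re
      = 2 * ((⟪G Ψ, H (G Ψ)⟫_ℂ).re - e * ‖G Ψ‖ ^ 2) := by
    have h3 : (2 * (⟪G Ψ, H (G Ψ)⟫_ℂ - (e : ℂ) * (‖G Ψ‖ : ℂ) ^ 2)).re
        = 2 * (⟪G Ψ, H (G Ψ)⟫_ℂ - (e : ℂ) * (‖G Ψ‖ : ℂ) ^ 2).re := by
      simp [Complex.mul_re]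
    rw [h3, Complex.sub_re, r1]
  rw [h2] at h
  linarith

end IMS

section Comb

/-- **Comb bound.** If `σ : κ → ι` is injective with values in `S`, the weights satisfy
`w d ≤ s`, `0 ≤ s`, and the occupations `n i ≥ 0` on `S`, then `Σ_d w d · n (σ d) ≤ s · Σ_{i ∈ S} n i`.
(Application: `γ_Φ(p,p) = Σ_d |c_d|² n(p - d k_L e₁) ≤ (max|c_d|²) N`.) -/
theorem sum_mul_comp_le_of_injective {ι κ : Type*} [Fintype κ] [DecidableEq ι] (S : Finset ι)
    (σ : κ → ι) (hσ : Function.Injective σ) (hS : ∀ d, σ d ∈ S) (w : κ → ℝ) (n : ι → ℝ)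
    (s : ℝ) (hs : 0 ≤ s) (hws : ∀ d, w d ≤ s) (hn : ∀ i ∈ S, 0 ≤ n i) :
    ∑ d, w d * n (σ d) ≤ s * ∑ i ∈ S, n i := by
  classical
  have step1 : ∑ d, w d * n (σ d) ≤ ∑ d, s * n (σ d) := by
    refine Finset.sum_le_sum fun d _ => ?_
    exact mul_le_mul_of_nonneg_right (hws d) (hn _ (hS d))
  have step2 : ∑ d, n (σ d) = ∑ i ∈ Finset.univ.image σ, n i := by
    rw [Finset.sum_image fun a _ b _ hab => hσ hab]
  have step3 : ∑ i ∈ Finset.univ.image σ, n i ≤ ∑ i ∈ S, n i := by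
    refine Finset.sum_le_sum_of_subset_of_nonneg ?_ fun i hi _ => hn i hi
    intro i hi
    obtain ⟨d, -, rfl⟩ := Finset.mem_image.mp hi
    exact hS d
  calc ∑ d, w d * n (σ d) ≤ ∑ d, s * n (σ d) := step1
    _ = s * ∑ d, n (σ d) := by rw [Finset.mul_sum]
    _ = s * ∑ i ∈ Finset.univ.image σ, n i := by rw [step2]
    _ ≤ s * ∑ i ∈ S, n i := mul_le_mul_of_nonneg_left step3 hs

end Comb

section Gershgorin

/-- **Gershgorin / Schur step.** Every eigenvalue of a finite complex matrix has real part at most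
`D + R`, where `D` bounds the real parts of the diagonal entries and `R` bounds every off-diagonal
absolute row sum. (For a Hermitian matrix this bounds `λ_max`; application: finite sections of the
one-particle density matrix of a boost superposition.) -/
theorem eigenvalue_re_le_of_diag_le_of_rowSum_le {n : Type*} [Fintype n] [DecidableEq n]
    {A : Matrix n n ℂ} {μ : ℂ} (hμ : Module.End.HasEigenvalue (Matrix.toLin' A) μ) (D R : ℝ)
    (hD : ∀ k, (A k k).re ≤ D) (hR : ∀ k, ∑ j ∈ Finset.univ.erase k, ‖A k j‖ ≤ R) :
    μ.re ≤ D + R := by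
  obtain ⟨k, hk⟩ := eigenvalue_mem_ball hμ
  rw [Metric.mem_closedBall, dist_eq_norm] at hk
  have h1 : (μ - A k k).re ≤ ‖μ - A k k‖ := Complex.re_le_norm _
  have h2 : μ.re = (μ - A k k).re + (A k k).re := by simp
  rw [h2]
  linarith [hD k, hR k]

end Gershgorin

end Summit.AtomisticToContinuum.BoseEinsteinCondensation.Theorems
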